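import Summits.QuantumFields.BalabanUV.T4Continuum.Support.NE7Route1ApexSeam

/-!
# Spine estimate NE7 — route 1's APEX SEAM FROM A CUTOFF ON, and the masking ∕ table-extension tools (seat ne7, file 22)

HONEST FRAMING (page 1): bookkeeping over tree theorems on ONE fixed finite torus T⁴ (rung (B)+1 of the cell's ladder);
NE7 is NOT proved (spine 0/9); NOT infinite volume, NOT a mass gap, NOT Clay; nothing of Bałaban's is asserted — every
analytic input below is a HYPOTHESIS SHAPE (NE7b's `RelWeightBound`, NE7c's `ShellWeightBound`, road P1's `GoodClause`,
NODE O's E1∕E2 dictionary), exactly as in `NE7Route1ApexSeam.stringwiseMatching_of_route1_end` (t4-ne7-p1 lineage,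
p309468), which is USED AS A PATTERN, not edited.  [folklore] throughout; NO definitions; no cite tags.

WHY (cell `pub-balaban-gaps`, lens L-8 of g1-plan-2; seat ne7 gen 7, files 21–23).  The apex reads every string FROM SOME
CUTOFF ON (`T4MatchingAssembly.StringHybridNE7 S os l₀ vol K₀`: run A = `K₀ + K` steps; the head is free by
`T4MatchingAssembly.head_of_abs_genFun_le`), and route 1's seam already SHIFTS the END's clause by a produced `K₀`
(`WeightRoute.hybridNE7_tail_of_goodClause`).  Hence the END's `GoodClause` is only ever needed FROM SOME CUTOFF ON.  §2
states the seam in that form — **`stringwiseMatching_of_route1_end_shifted`**: per string, the two weight structures and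
the dictionary UNSHIFTED (as in the seam), but road P1's clause on the hybrid cores only for the `K₁`-SHIFTED families,
`GoodClause l₀ vol (T ∘ (K₁+·)) … δ` with `Summable δ` ⇒ `T4ApexVariance.StringwiseMatching S`; and
`matchingUnder_of_route1_end_shifted`, the same under the prefix for Bałaban's data.  File 23 produces exactly this
shifted clause from route 1's docked END with the flow window (0.31) asked from `K₁` on (black box); §1 holds the two
tools it uses — `mask_restrict[_imp]` (a binder on the good classes `T K ∖ Bad K t` restricts to the classes masked below
`K₁`) and `exists_literal031_extension` (tables obeying (0.31) from `K₁` on extend to tables obeying it at every cutoff,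
equal to the given ones from `K₁` on; the compatibility `b ≤ β′` is read off the window at cutoff `K₁ + 1`).

Reference (LOCATOR only): [Balaban1987RG1] T. Bałaban, Commun. Math. Phys. 109 (1987) 249–301, (0.31) p. 259.
-/

set_option autoImplicit false

open Finset MeasureTheory

namespace Summit.QuantumFields.BalabanUV.T4Continuum.Spine.NE7.SlotBetaKeyingSeam

open Literature.MathematicalPhysics.QuantumFieldTheory.Balaban1983to89
open Missing T4Continuum T4WeightBudget T4IndicatorShell T4GoodClassBudget T4MatchingAssembly
open T4MatchingClosureSocket (relWeightBound_shift shellWeightBound_shift)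
open Summit.QuantumFields.BalabanUV.T4Continuum.WeightRoute (hybridNE7_tail_of_goodClause)

universe u

/-! ## §1 Tools: masking the good classes below a cutoff; extending a coupling table literally below a cutoff -/

/-- A binder on the good classes `T K ∖ Bad K t` restricts to the classes MASKED below `K₁` (`T K` for `K ≥ K₁`, `∅` below).
[folklore] -/
theorem mask_restrict {σ : Type*} [DecidableEq σ] {T : ℕ → Finset σ} {Bad : ℕ → ℝ → Finset σ} {l₀ : ℝ} {K₁ : ℕ}
    {P : ℕ → ℝ → σ → Prop} (h : ∀ K t, |t| ≤ l₀ → ∀ τ ∈ T K \ Bad K t, P K t τ) :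
    ∀ K t, |t| ≤ l₀ → ∀ τ ∈ (if K₁ ≤ K then T K else ∅) \ Bad K t, P K t τ := by
  intro K t ht τ hτ
  by_cases hK : K₁ ≤ K
  · rw [if_pos hK] at hτ
    exact h K t ht τ hτ
  · rw [if_neg hK] at hτ
    simp at hτ

/-- The same with a change of the bound property from `K₁` on (for binders whose coupling tables are replaced by tables
EQUAL to them from `K₁` on). [folklore] -/
theorem mask_restrict_imp {σ : Type*} [DecidableEq σ] {T : ℕ → Finset σ} {Bad : ℕ → ℝ → Finset σ} {l₀ : ℝ} {K₁ : ℕ}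
    {P Q : ℕ → ℝ → σ → Prop} (h : ∀ K t, |t| ≤ l₀ → ∀ τ ∈ T K \ Bad K t, P K t τ)
    (hPQ : ∀ K, K₁ ≤ K → ∀ t τ, P K t τ → Q K t τ) :
    ∀ K t, |t| ≤ l₀ → ∀ τ ∈ (if K₁ ≤ K then T K else ∅) \ Bad K t, Q K t τ := by
  intro K t ht τ hτ
  by_cases hK : K₁ ≤ K
  · rw [if_pos hK] at hτ
    exact hPQ K hK t τ (h K t ht τ hτ)
  · rw [if_neg hK] at hτ
    simp at hτ

/-- At cutoffs `K₁ + K` the masked classes are the classes. [folklore] -/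
theorem mask_add {σ : Type*} (T : ℕ → Finset σ) (K₁ K : ℕ) :
    (if K₁ ≤ K₁ + K then T (K₁ + K) else ∅) = T (K₁ + K) := if_pos (Nat.le_add_right K₁ K)

/-- The flow window (0.31) (tree `Step.Discrete031`) at ONE cutoff `K ≥ 1` forces `b ≤ β′` (read at level `K − 1`).
[folklore] -/
theorem slope_le_of_discrete031 {b β' g : ℝ} {K : ℕ} {gs : ℕ → ℝ} (hK : 1 ≤ K)
    (h : Step.Discrete031 b β' K g gs) : b ≤ β' := by
  obtain ⟨h1, h2⟩ := h (K - 1) (by omega)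
  have e : ((K : ℝ) - ((K - 1 : ℕ) : ℝ)) = 1 := by
    rw [Nat.cast_sub hK]; push_cast; ring
  rw [e] at h1 h2
  linarith

/-- **LITERAL EXTENSION BELOW A CUTOFF.**  Tables obeying the flow window (0.31) (`b > 0`) at cutoffs `K ≥ K₁`,
nonnegative, extend to tables obeying it at EVERY cutoff, nonnegative, and EQUAL to the given ones from `K₁` on: below
`K₁` take the endpoint `1` and `1/g_k² = 1 + b(K−k)` (its upper half uses `b ≤ β′`, read off the given window at cutoff
`K₁ + 1`).  The dummy cutoffs carry no data. [folklore] -/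
theorem exists_literal031_extension {b β' : ℝ} {K₁ : ℕ} {gf : ℕ → ℝ} {gs : ℕ → ℕ → ℝ} (hb : 0 < b)
    (h031 : ∀ K, K₁ ≤ K → Step.Discrete031 b β' K (gf K) (gs K)) (hpos : ∀ K k, k ≤ K → 0 ≤ gs K k) :
    ∃ gf' : ℕ → ℝ, ∃ gs' : ℕ → ℕ → ℝ, (∀ K, Step.Discrete031 b β' K (gf' K) (gs' K)) ∧
      (∀ K k, k ≤ K → 0 ≤ gs' K k) ∧ (∀ K, K₁ ≤ K → gs' K = gs K) := by
  have hbβ' : b ≤ β' := slope_le_of_discrete031 (K := K₁ + 1) (by omega) (h031 (K₁ + 1) (by omega))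
  refine ⟨fun K => if K₁ ≤ K then gf K else 1,
    fun K => if K₁ ≤ K then gs K else fun k => Real.sqrt (1 / (1 + b * ((K : ℝ) - k))), ?_, ?_, ?_⟩
  · intro K
    by_cases hK : K₁ ≤ K
    · simp only [if_pos hK]; exact h031 K hK
    · simp only [if_neg hK]
      intro k hk
      have hKk : 0 ≤ (K : ℝ) - k := sub_nonneg.2 (by exact_mod_cast hk)
      have hx : 0 < 1 + b * ((K : ℝ) - k) := by positivity
      rw [Real.sq_sqrt (one_div_pos.2 hx).le, one_div_one_div, one_pow, div_one]
      exact ⟨le_rfl, by nlinarith [mul_le_mul_of_nonneg_right hbβ' hKk]⟩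
  · intro K k hk
    by_cases hK : K₁ ≤ K
    · simp only [if_pos hK]; exact hpos K k hk
    · simp only [if_neg hK]; exact Real.sqrt_nonneg _
  · intro K hK
    simp only [if_pos hK]

/-! ## §2 Route 1's apex seam with road P1's clause asked for the `K₁`-SHIFTED families only -/

section Scheme

variable {G : Type*} [GaugeGroup G] [MeasurableSpace G] [RegularGaugeGroup G] [HaarData G] {O : Type*}

/-- **ROUTE 1's END → APEX SEAM, the clause FROM A CUTOFF ON** (`NE7Route1ApexSeam.stringwiseMatching_of_route1_end` with
road P1's `GoodClause` on the hybrid cores asked only for the `K₁`-shifted families, `K₁` per string; the weight structures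
and the E1∕E2 dictionary unshifted, as there).  Proof: shift the two weight structures by `K₁`
(`T4MatchingClosureSocket.relWeightBound_shift` ∕ `shellWeightBound_shift`), `WeightRoute.hybridNE7_tail_of_goodClause` on
the shifted families (it produces a further offset `K₀`), re-index the dictionary by `K₁ + K₀`,
`T4ApexVariance.stringwiseMatching_of_stringwiseHybridNE7`.  Hypothesis shapes only; nothing printed is asserted; NOT NE7.
[folklore] -/
theorem stringwiseMatching_of_route1_end_shifted (S : TorusScheme G O) (hβ : ∀ K, 0 ≤ S.β K)
    (hm : ∀ K o, Measurable (S.obs K o)) (h1 : ∀ K o U, |S.obs K o U| ≤ 1)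
    (h : ∀ os : List O, ∃ (ι : Type) (_ : DecidableEq ι) (l₀ vol : ℝ) (K₁ : ℕ) (T : ℕ → Finset ι)
        (A B shA shB : ℕ → ℝ → ι → ℝ) (Bad : ℕ → ℝ → Finset ι) (W Wsh δ : ℕ → ℝ),
        0 < l₀ ∧ 0 < vol ∧
        RelWeightBound l₀ T A B Bad W ∧ ShellWeightBound l₀ T A B shA shB Wsh ∧ Summable δ ∧
        GoodClause l₀ vol (fun K => T (K₁ + K)) (fun K t τ => A (K₁ + K) t τ - shA (K₁ + K) t τ)
          (fun K t τ => B (K₁ + K) t τ - shB (K₁ + K) t τ) (fun K => Bad (K₁ + K)) δ ∧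
        (∀ K t, |t| ≤ l₀ → T4GenFunBounds.schemeZ S os K t = ∑ τ ∈ T K, A K t τ) ∧
        (∀ K t, |t| ≤ l₀ → T4GenFunBounds.schemeZ S os (K + 1) t = ∑ τ ∈ T K, B K t τ)) :
    T4ApexVariance.StringwiseMatching S := by
  refine T4ApexVariance.stringwiseMatching_of_stringwiseHybridNE7 S hβ hm h1 fun os => ?_
  obtain ⟨ι, _, l₀, vol, K₁, T, A, B, shA, shB, Bad, W, Wsh, δ, hl₀, hvol, hW, hSh, hδ, hcore, hZA, hZB⟩ := h os
  obtain ⟨K₀, hH⟩ := hybridNE7_tail_of_goodClause (vol := vol) (relWeightBound_shift K₁ hW)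
    (shellWeightBound_shift K₁ hSh) hδ hcore
  refine ⟨l₀, vol, K₁ + K₀, hl₀, hvol, ι, ‹DecidableEq ι›, _, _, _, _, _, _, _, _, _, hH, ?_, ?_⟩
  · intro K t ht
    simpa [Nat.add_assoc] using hZA (K₁ + (K₀ + K)) t ht
  · intro K t ht
    simpa [Nat.add_assoc] using hZB (K₁ + (K₀ + K)) t ht

end Scheme

section Prefix

variable {F : T4Family} {G : Type u} [GaugeGroup G] [MeasurableSpace G] [RegularGaugeGroup G] [HaarData G]

/-- **The same seam UNDER THE PREFIX for Bałaban's data** (`NE7Route1ApexSeam.matchingUnder_of_route1_end` with the clause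
from a cutoff on): `T4ApexVariance.MatchingUnder D Hβ`.  Hypothesis shapes only; nothing printed is asserted. [folklore] -/
theorem matchingUnder_of_route1_end_shifted (D : FiniteEpsData F G) (hM : D.AvgMeasurable) {Hβ : Prop}
    (h : D.UnderHypotheses Hβ fun g₀ => ∀ os, ∃ (ι : Type) (_ : DecidableEq ι) (l₀ vol : ℝ) (K₁ : ℕ)
        (T : ℕ → Finset ι) (A B shA shB : ℕ → ℝ → ι → ℝ) (Bad : ℕ → ℝ → Finset ι) (W Wsh δ : ℕ → ℝ),
        0 < l₀ ∧ 0 < vol ∧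
        RelWeightBound l₀ T A B Bad W ∧ ShellWeightBound l₀ T A B shA shB Wsh ∧ Summable δ ∧
        GoodClause l₀ vol (fun K => T (K₁ + K)) (fun K t τ => A (K₁ + K) t τ - shA (K₁ + K) t τ)
          (fun K t τ => B (K₁ + K) t τ - shB (K₁ + K) t τ) (fun K => Bad (K₁ + K)) δ ∧
        (∀ K t, |t| ≤ l₀ → T4GenFunBounds.schemeZ (D.scheme g₀) os K t = ∑ τ ∈ T K, A K t τ) ∧
        (∀ K t, |t| ≤ l₀ → T4GenFunBounds.schemeZ (D.scheme g₀) os (K + 1) t = ∑ τ ∈ T K, B K t τ)) :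
    T4ApexVariance.MatchingUnder D Hβ :=
  FiniteEpsData.UnderHypotheses.mono (fun g₀ hg =>
    stringwiseMatching_of_route1_end_shifted (D.scheme g₀) (fun K => (D.scheme_β_eq g₀ K).2)
      (fun K C => D.measurable_avgObs hM K C) (fun K C U => D.abs_avgObs_le_one K C U) hg) h

end Prefix

end Summit.QuantumFields.BalabanUV.T4Continuum.Spine.NE7.SlotBetaKeyingSeam
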